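import Literature.MathematicalPhysics.QuantumFieldTheory.BalabanImbrieJaffe1984to88.BIJ88Extraction311TwoCase
import Literature.MathematicalPhysics.QuantumFieldTheory.BalabanImbrieJaffe1984to88.BIJ88CovSandwich311

/-!
# `BalabanImbrieJaffe1984to88.BIJ88IneqW6FromLeaves` — T. Bałaban, J. Imbrie, A. Jaffe, *Effective action and cluster properties of the
abelian Higgs model*, Commun. Math. Phys. **114** (1988) 257–315 [BalabanImbrieJaffe1988]: Sect. 5.14, p. 311 [PDF 55] — the two-case bound
*"|W₆^{(k)}(X)| ≤ (e^β(L^kε/ε₀)^{1/4−α})^{n̄+1+β′|X|}, dist(X, Λ₁₂^{(k),c}) ≥ r(e_k); (e^β(L^kε/ε₀)^{1/4−α})^{β′|X|}, otherwise"* for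
`W₆ = W₆′ + W₆″` (`W₆″ = BIJ88Extraction311.W6pp`) WITH THE SOURCE SIZES FED BY NAME, as r16 asked (lit-balaban-p31/INBOX 2026-08-22T06:01Z,
06:29Z): the random-walk pieces from r18's leaf **`BIJ88Sect2Statements.Ineq246`** ((2.46) *"|C^{(k)}_{Λ,X}(u;x₁,x₂)| ≦ e^{−cr(e_k)|X|}"*), the
`O(e^{−cr(e_k)})` pieces from r18's **`Close`** ((2.47) shape) / p36's **`BIJ88CovSandwich311.trunc_close`** through an explicit pair-hull
localization (`ineq246_of_close_hull`, `ineq246_of_decay_trunc`), the `W₆′` half from the leaf **`IneqW6′`** (p25's `ineqW6'_of_ineq5144` ←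
`Ineq5144`), and the vertex-factor rule p. 298 *"each vertex results in at least a factor e^β(L^kε/ε₀)^{1/4−α}"* as THIS ROW'S located
hypothesis (T*) in multilinear sup-norm form; conclusion r16's leaf **`BIJ88Sect5StatementsPart2.IneqW6`** (`ineqW6_of_leaves`)

statement-level skeleton of published theorems with citation tags; proofs where landed; nothing here is a claim about the Yang–Mills mass gap

PDF held: `paper:balaban1988-cmp114-bij-abelian-higgs-effective-action` (journal page = PDF page + 256); pp. 264–265 [PDF 8–9] and 310–311
[PDF 54–55] read this session as images (`HOME/lit-balaban-p31/renders/original-p008/p054/p055-x2.png`).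

CITATION HEADER (verbatim).  (2.45)–(2.47) pp. 264–265: *"Then we define C^{(k)}_Λ(u) = C^{(k)}_{Λ,loc}(u) + Σ_X C^{(k)}_{Λ,X}(u), (2.45) …
The operator C^{(k)}_{Λ,X}(u) depends only on u in X. It vanishes unless both arguments are in X, and is estimated as follows:
|C^{(k)}_{Λ,X}(u;x₁,x₂)| ≦ e^{−cr(e_k)|X|}. (2.46) Here and elsewhere, |X| refers to the number of r(e_k)-cubes in X, not the volume of X. …
|C^{(k)}_{Λ,loc}(u;x₁,x₂) − C^{(k)}_Λ(u;x₁,x₂)| ≦ e^{−cr(e_k)}. (2.47)"*; p. 310 [PDF 54]: *"The others, localized in region X, have a factor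
of e^{−cr(e_k)|X|}."*; p. 311 [PDF 55]: *"We can then replace C^{(k)}_{ℤ^d,loc} with C^{(k)}_{loc}, the difference being O(e^{−cr(e_k)}) and
localizable as above. … terms localized near Λ₁₂^{(k)c}. These terms are bounded by a small power of coupling constants … If we put W₆^{(k)}(X) =
W₆^{(k)′}(X) + W₆^{(k)″}(X), then W₆^{(k)}(X) obeys |W₆^{(k)}(X)| ≤ (e^β(L^kε/ε₀)^{1/4−α})^{n̄+1+β′|X|}, dist(X, Λ₁₂^{(k),c}) ≥ r(e_k);
(e^β(L^kε/ε₀)^{1/4−α})^{β′|X|}, otherwise."*; p. 298 [PDF 42]: *"each vertex results in at least a factor e^β(L^kε/ε₀)^{1/4−α}"*.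

WHAT IS REPRODUCED.  SKELETON row **C2.Claim@310** of `HOME/lit-balaban-r16/ROWS-C2-part2.md` (head typed at v2.96; r16's pre-recorded HEAD CALL for
the sequel of `BIJ88Extraction311Bound`: «proved with clauses» needs (RW) fed BY NAME from the (2.46) row — r18's `Ineq246`, not only its shape —
and (T) by name from the §5.10 vertex-factor statement or displayed as the row's leaf; (B)/(N) may stay located bookkeeping hypotheses; reading (a)
front-loaded).  Fourth file of this seat's p. 311 chain: `BIJ88ScalarComposition311` (p319635), `BIJ88Extraction311` (p319972), `BIJ88Extraction311Bound`
(p320565), `BIJ88Extraction311TwoCase` (p320897).  Cell `lit-balaban`, HOME `run/shared/lean/pub/lit-balaban/`; Phase-2 seat p31 gen 12 = unit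
`lit-balaban-p31-g12`; owner r16, referee ref-5.

WHAT IS PROVED (theorems only; 0 `sorry`; 0 defs / 0 `Prop` facts).  Kernels `α → α → ℝ` on sites `α`; regions = finite sets of `r(e_k)`-cubes
(`Finset ι`, `|X|` = `card`).
§1 **(2.47)-shape ⇒ (2.46)-shape** (the sentence *"the difference being O(e^{−cr(e_k)}) and localizable as above"* made explicit): for a kernel pair
  with r18's `Close dist Kloc K δ c′` (`|Kloc − K| ≤ δe^{−c′dist}`), the PAIR-HULL localization `X ↦ [hull(a,b) = X]·(Kloc − K)(a,b)` — `hull a b` any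
  region containing both points with `|hull(a,b)| ≤ 1 + κ·dist(a,b)/r(e_k)` — resums to `Kloc − K` over any family of regions containing the hulls
  (`sum_hullPieces`) and satisfies r18's **`Ineq246 card mem · (c′/κ) r(e_k)`** as soon as `δ ≤ e^{−(c′/κ)r(e_k)}` (`ineq246_of_close_hull`); chained
  with p36's `trunc_close` ((2.41)-type `Decay dist K c` ⇒ the sharp truncation is `Close`): `ineq246_of_decay_trunc`.
§2 **`ineqW6_of_leaves`**: r16's leaf `IneqW6 (cubeSys ι) (fun X => W₆′ X + W6pp … A W′ X) far θ′ β′ n̄` from — (T*) the located vertex-factor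
  hypothesis *"each vertex results in at least a factor θ"* in multilinear sup-norm form: for EVERY family of pointwise bounds `B r ≥ 0` of the piece
  kernels, `|term γ x a| ≤ θ^{ord γ}·Π_i B(a i)` (standard slots contribute 1); (RW) BY NAME: every interior piece `r ∈ pc s` IS a localized kernel
  `E s r = CX s (reg r)` of a family with **`Ineq246 card mem (CX s) c r(e_k)`** (r18's (2.46) statement; for the `O(e^{−cr})` species the family of §1);
  (B) located: boundary-piece kernels bounded pointwise by `1`, regions of `≤ b₀` cubes near `Λ₁₂^c` (`reg r ⊆ X → ¬ far X`); (N) located multiplicity;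
  `far X → X ⊆ W′`; the explicit smallness conditions (S1a) (S1b) (S2) (S3) (S4) of `BIJ88Extraction311TwoCase` with `cr = c·r(e_k)`; and the leaf
  `IneqW6′ (cubeSys ι) W₆′ θ₁ β₁ n̄` with `4θ₁^{n̄+1} ≤ θ′^{n̄+1}`, `θ₁^{β₁} ≤ θ′^{β′}`.  Proof: the sizes `ε r = [bd r] + [¬ bd r]e^{−c r(e_k)|reg r|}` satisfy
  the hypotheses of `BIJ88Extraction311TwoCase.ineqW6_of_extraction`, (2.46) supplying the pointwise bounds.
HONEST SCOPE.  (T*) is the p. 298/p. 310 rule as a DISPLAYED HYPOTHESIS of this row (the paper's *"standard exercise"*), with `θ` any number in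
`[0,1]` (in the application `θ = BIJ88Sect5StatementsPart2.vertexFactor β s α`); (B) and (N) are located bookkeeping hypotheses; the identification
of the interior pieces with (2.46)-kernels is the declared reading (a) of `BIJ88Extraction311` (front-loaded); the pair-hull localization of §1 is
ONE admissible way to localize an `O(e^{−cr})` difference *"as above"*, with the printed generic constants (`c′/κ`, `δ ≤ e^{−(c′/κ)r}`) explicit — the
paper does not specify its localization.  Constants of the conclusion are adjusted ones (explicit sufficient conditions).  NOT summit progress.
-/

namespace Literature.MathematicalPhysics.QuantumFieldTheory.BalabanImbrieJaffe1984to88.BIJ88IneqW6FromLeaves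

open Finset
open Literature.MathematicalPhysics.QuantumFieldTheory.BalabanImbrieJaffe1984to88.BIJ88Sect2Statements (Ineq246 Close Decay trunc)
open Literature.MathematicalPhysics.QuantumFieldTheory.BalabanImbrieJaffe1984to88.BIJ88CovSandwich311 (trunc_close)
open Literature.MathematicalPhysics.QuantumFieldTheory.BalabanImbrieJaffe1984to88.BIJ88Sect5StatementsPart2 (IneqW6 IneqW6')
open Literature.MathematicalPhysics.QuantumFieldTheory.BalabanImbrieJaffe1984to88.BIJ88Ineq5113Covering (cubeSys)
open Literature.MathematicalPhysics.QuantumFieldTheory.BalabanImbrieJaffe1984to88.BIJ88Extraction311 (choices term W6pp)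
open Literature.MathematicalPhysics.QuantumFieldTheory.BalabanImbrieJaffe1984to88.BIJ88Extraction311TwoCase (ineqW6_of_extraction)

noncomputable section

variable {ι : Type} [DecidableEq ι] {α : Type*}

/-! ## §1 `O(e^{−cr(e_k)})` differences *"localizable as above"*: (2.47)-shape ⇒ (2.46)-shape by pair hulls -/

omit [DecidableEq ι] in
/-- The pair-hull localization resums to the difference: `Σ_{X ∈ 𝒳} [hull(a,b) = X]·D(a,b) = D(a,b)` whenever `hull(a,b) ∈ 𝒳`.
[cite: BalabanImbrieJaffe1988, p.311 (Sect. 5.14)] -/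
theorem sum_hullPieces [DecidableEq (Finset ι)] (hull : α → α → Finset ι) (Dk : α → α → ℝ) (𝒳 : Finset (Finset ι)) {a b : α}
    (h : hull a b ∈ 𝒳) : ∑ X ∈ 𝒳, (if hull a b = X then Dk a b else 0) = Dk a b := by
  rw [sum_ite_eq, if_pos h]

omit [DecidableEq ι] in
/-- **(2.47)-shape ⇒ (2.46)-shape.**  If `|Kloc(a,b) − K(a,b)| ≤ δe^{−c′dist(a,b)}` (r18's `Close`), every `hull a b` contains both points and has
`|hull(a,b)| ≤ 1 + κ·dist(a,b)/r` cubes (`κ, r > 0`, `c′ ≥ 0`), and `δ ≤ e^{−(c′/κ)r}`, then the pair-hull pieces `X ↦ [hull(a,b) = X](Kloc − K)(a,b)`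
satisfy r18's `Ineq246 card mem · (c′/κ) r`: they vanish unless both arguments lie in `X` and are `≤ e^{−(c′/κ)·r·|X|}` pointwise.
[cite: BalabanImbrieJaffe1988, (2.46)-(2.47) p.264-265] -/
theorem ineq246_of_close_hull [DecidableEq (Finset ι)] {dist : α → α → ℝ} {Kloc K : α → α → ℝ} {δ c' : ℝ} (hK : Close dist Kloc K δ c')
    (hull : α → α → Finset ι) (mem : α → Finset ι → Prop) (hmem : ∀ a b, mem a (hull a b) ∧ mem b (hull a b))
    {κ r : ℝ} (hκ : 0 < κ) (hr : 0 < r) (hc' : 0 ≤ c') (hcard : ∀ a b, ((hull a b).card : ℝ) ≤ 1 + κ * dist a b / r)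
    (hδ : δ ≤ Real.exp (-(c' / κ) * r)) :
    Ineq246 (fun X : Finset ι => X.card) mem (fun X a b => if hull a b = X then Kloc a b - K a b else 0) (c' / κ) r := by
  refine ⟨fun X a b h => ?_, fun X a b => ?_⟩
  · dsimp only
    by_cases hX : hull a b = X
    · exact absurd ⟨hX ▸ (hmem a b).1, hX ▸ (hmem a b).2⟩ h
    · rw [if_neg hX]
  · dsimp only
    by_cases hX : hull a b = X
    · rw [if_pos hX]
      refine (hK a b).trans ?_
      have hκ0 : κ ≠ 0 := hκ.ne'
      have hr0 : r ≠ 0 := hr.ne'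
      have h2 : (X.card : ℝ) - 1 ≤ κ * dist a b / r := by have := hcard a b; rw [hX] at this; linarith
      have h1 : c' / κ * r * ((X.card : ℝ) - 1) ≤ c' * dist a b := by
        calc c' / κ * r * ((X.card : ℝ) - 1) ≤ c' / κ * r * (κ * dist a b / r) := mul_le_mul_of_nonneg_left h2 (by positivity)
          _ = c' * dist a b := by field_simp
      calc δ * Real.exp (-c' * dist a b) ≤ Real.exp (-(c' / κ) * r) * Real.exp (-(c' / κ * r * ((X.card : ℝ) - 1))) :=
            mul_le_mul hδ (Real.exp_le_exp.2 (by linarith)) (Real.exp_nonneg _) (Real.exp_nonneg _)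
        _ = Real.exp (-(c' / κ) * r * (X.card : ℝ)) := by rw [← Real.exp_add]; congr 1; ring
    · rw [if_neg hX, abs_zero]
      positivity

omit [DecidableEq ι] in
/-- **p36's `trunc_close` chained**: for a kernel with the (2.41)-type decay `|K(a,b)| ≤ ce^{−c dist(a,b)}` (r18's `Decay`), the difference of its
sharp truncation `K̃ = trunc dist R K` ((2.8), p. 311's `O(e^{−cr(e_k)})` middle factor) localized by pair hulls satisfies `Ineq246 card mem · (c/2/κ) r`
once `c·e^{−(c/2)R} ≤ e^{−(c/2/κ)r}`. [cite: BalabanImbrieJaffe1988, p.311 (Sect. 5.14)] -/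
theorem ineq246_of_decay_trunc [DecidableEq (Finset ι)] {dist : α → α → ℝ} {K : α → α → ℝ} {c : ℝ} (hc : 0 ≤ c) (hK : Decay dist K c)
    (R : ℝ) (hull : α → α → Finset ι) (mem : α → Finset ι → Prop) (hmem : ∀ a b, mem a (hull a b) ∧ mem b (hull a b))
    {κ r : ℝ} (hκ : 0 < κ) (hr : 0 < r) (hcard : ∀ a b, ((hull a b).card : ℝ) ≤ 1 + κ * dist a b / r)
    (hδ : c * Real.exp (-(c / 2) * R) ≤ Real.exp (-(c / 2 / κ) * r)) :
    Ineq246 (fun X : Finset ι => X.card) mem (fun X a b => if hull a b = X then trunc dist R K a b - K a b else 0) (c / 2 / κ) r :=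
  ineq246_of_close_hull (trunc_close hc hK R) hull mem hmem hκ hr (by positivity) hcard hδ

/-! ## §2 The two-case bound with the source sizes by name -/

variable {S : Type*} {D : Type*} [Fintype D] {P : Type*} [DecidableEq P]
variable (m : D → ℕ) (spec : (γ : D) → Fin (m γ) → S) (T : (γ : D) → ι → MultilinearMap ℝ (fun _ : Fin (m γ) => α → α → ℝ) ℝ)
variable (Cstd : S → α → α → ℝ) (pc : S → Finset P) (E : S → P → α → α → ℝ) (reg : P → Finset ι) (ord : D → ℕ) (nbar : ℕ)

/-- **p. 311, `IneqW6` for `W₆ = W₆′ + W₆″` with the source sizes BY NAME.**  Hypotheses: (N) multiplicity `q`, `m γ ≤ M` slots, `0 ≤ θ ≤ 1`,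
`ord ≥ 1`; **(T*)** (p. 298 vertex-factor rule, located; multilinear sup-norm form): for every family `B ≥ 0` of pointwise bounds of the piece
kernels (`|E s r(x₁,x₂)| ≤ B r` for `r ∈ pc s`), `|term γ x a| ≤ θ^{ord γ}·Π_i (a i).elim 1 B`; **(RW) by name**: a family `CX s` of localized
kernels per species with r18's `Ineq246 card mem (CX s) c r(e_k)` ((2.46); for the `O(e^{−cr})` species see §1) and every interior piece IS one of
them, `E s r = CX s (reg r)`, with `reg r ≠ ∅`; **(B)** located: boundary-piece kernels `≤ 1` pointwise, `|reg r| ≤ b₀`, regions near `Λ₁₂^c`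
(`reg r ⊆ X → ¬ far X`); `far X → X ⊆ W′`; the smallness conditions (S1a)–(S4) with `cr = c·r(e_k)` on the adjusted `0 < θ′ ≤ 1`, `0 ≤ β′`; the leaf
`IneqW6′ (cubeSys ι) W₆′ θ₁ β₁ n̄` (p. 310, from (5.14.4) by p25's `ineqW6'_of_ineq5144`) with `4θ₁^{n̄+1} ≤ θ′^{n̄+1}`, `θ₁^{β₁} ≤ θ′^{β′}`.
Conclusion: r16's leaf `IneqW6 (cubeSys ι) (fun X => W₆′ X + W6pp … A W′ X) far θ′ β′ n̄`. [cite: BalabanImbrieJaffe1988, p.311 (Sect. 5.14)] -/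
theorem ineqW6_of_leaves {q M b₀ : ℕ} (hq : 1 ≤ q) (hN : ∀ s X, ((pc s).filter (fun r => reg r ⊆ X)).card + 1 ≤ q ^ X.card)
    (hM : ∀ γ, m γ ≤ M) {θ : ℝ} (hθ0 : 0 ≤ θ) (hθ1 : θ ≤ 1) (hord : ∀ γ, 1 ≤ ord γ)
    {bd : P → Prop} [DecidablePred bd] {c rek : ℝ} (hc : 0 ≤ c) (hrek : 0 ≤ rek)
    (hT : ∀ B : P → ℝ, (∀ r, 0 ≤ B r) → (∀ s, ∀ r ∈ pc s, ∀ x₁ x₂, |E s r x₁ x₂| ≤ B r) →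
      ∀ γ x a, a ∈ choices m spec pc γ → |term m spec T Cstd E γ x a| ≤ θ ^ ord γ * ∏ i, ((a i).elim (1 : ℝ) B))
    {mem : α → Finset ι → Prop} (CX : S → Finset ι → α → α → ℝ) (h246 : ∀ s, Ineq246 (fun X : Finset ι => X.card) mem (CX s) c rek)
    (hE : ∀ s, ∀ r ∈ pc s, ¬ bd r → E s r = CX s (reg r)) (hne : ∀ r, ¬ bd r → (reg r).Nonempty)
    (hB : ∀ s, ∀ r ∈ pc s, bd r → ∀ x₁ x₂, |E s r x₁ x₂| ≤ 1) (hb₀ : ∀ r, bd r → (reg r).card ≤ b₀)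
    {far : Finset ι → Prop} (hfarB : ∀ r, bd r → ∀ X, reg r ⊆ X → ¬ far X) {A W' : Finset ι} (hfarW : ∀ X, far X → X ⊆ W')
    {θ' β' θ₁ β₁ : ℝ} (hθ'0 : 0 < θ') (hθ'1 : θ' ≤ 1) (hβ' : 0 ≤ β') (hθ₁ : 0 < θ₁)
    (S1a : 2 * (q : ℝ) ^ M * Real.exp (-(c * rek / 4)) ≤ θ' ^ β')
    (S1b : 4 * Fintype.card D * θ * Real.exp (-(c * rek / 4)) ≤ θ' ^ ((nbar : ℝ) + 1))
    (S2 : 4 * Fintype.card D * θ ^ (nbar + 1) ≤ θ' ^ ((nbar : ℝ) + 1 + β'))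
    (S3 : 4 * Fintype.card D * θ ≤ θ' ^ β')
    (S4 : 4 * Fintype.card D * θ * (2 * (q : ℝ) ^ M) ^ (1 + M * b₀) ≤ (θ' ^ β') ^ (1 + M * b₀))
    {W6p : Finset ι → ℝ} (hW6p : IneqW6' (cubeSys ι) W6p θ₁ β₁ nbar)
    (hA1 : 4 * θ₁ ^ ((nbar : ℝ) + 1) ≤ θ' ^ ((nbar : ℝ) + 1)) (hB1 : θ₁ ^ β₁ ≤ θ' ^ β') :
    IneqW6 (cubeSys ι) (fun X => W6p X + W6pp m spec T Cstd pc E reg ord nbar A W' X) far θ' β' nbar := by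
  -- the sizes: boundary pieces 1, interior pieces e^{−c r(e_k)|reg r|}
  set ε : P → ℝ := fun r => if bd r then 1 else Real.exp (-(c * rek) * (reg r).card) with hε
  have hε0 : ∀ r, 0 ≤ ε r := fun r => by
    by_cases hr : bd r
    · simp [hε, hr]
    · simp only [hε, hr, if_false]; exact Real.exp_nonneg _
  have hεE : ∀ s, ∀ r ∈ pc s, ∀ x₁ x₂, |E s r x₁ x₂| ≤ ε r := by
    intro s r hr x₁ x₂
    by_cases hb : bd r
    · simpa [hε, hb] using hB s r hr hb x₁ x₂
    · rw [hE s r hr hb]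
      have h2 := (h246 s).2 (reg r) x₁ x₂
      dsimp only at h2
      simp only [hε, hb, if_false]
      convert h2 using 2
      ring
  have hint : ∀ r, ¬ bd r → ε r ≤ Real.exp (-(c * rek) * (reg r).card) ∧ (reg r).Nonempty := fun r hr =>
    ⟨by simp [hε, hr], hne r hr⟩
  have hbd : ∀ r, bd r → ε r ≤ 1 ∧ (reg r).card ≤ b₀ := fun r hr => ⟨by simp [hε, hr], hb₀ r hr⟩
  exact ineqW6_of_extraction m spec T Cstd pc E reg ord nbar hq hN hM hθ0 hθ1 hord (mul_nonneg hc hrek) hε0 hint hbd hfarB hfarW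
    (hT ε hε0 hεE) hθ'0 hθ'1 hβ' hθ₁ S1a S1b S2 S3 S4 hW6p hA1 hB1

end

end Literature.MathematicalPhysics.QuantumFieldTheory.BalabanImbrieJaffe1984to88.BIJ88IneqW6FromLeaves
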